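import Mathlib
import Summits.Ventures.PercRepro2.HubBernstein
import Summits.Ventures.PercRepro2.HCovCubic
import Summits.Ventures.PercRepro2.TriDisagreementPinned
import Summits.Ventures.PercRepro2.BernUnique
import Summits.Ventures.PercRepro2.PMTypedDict
import Summits.Ventures.PercRepro2.PMK5Typed
import Summits.Ventures.PercRepro2.PMPendantDict
import Summits.Ventures.PercRepro2.PMPendantBeta
import Summits.Ventures.PercRepro2.PMK5Pendant

/-!
# THE TYPED (PM) ON EVERY `K₅ + PENDANT a₃` INSTANCE — row 2′BETA1's statement of record, per profile
(blind cell PercRepro2, mine-2 g22; the per-profile shadow of Theorems 12, 13, 14)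

On `ends6` (`K₅` on `o = 0, a₁ = 1, a₂ = 2, u = 3, b = 4` plus the pendant edge `10 = {3, 5}`, `a₃ = 5`) let
`A k = fullCount K3 k` be the full-profile typed counts of the kernel `K3` of `Gc` (`PMTypedDict.lean`).  The
pendant dictionary (Theorem 13, `Gc_pendant_quadratic` + `twoBeta1_eq`), the kernel certificate of row 2′BETA1's
bracket in Bernstein form (`PMK5Typed.beta1_eq_bern`, coefficients `cntPosB − cntNegB ≥ 0`) and the
5 → 6-vertex transfer express `Gc p` on `ends6` in TWO ways as a tensor-Bernstein form in `p ∈ R^11`; the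
uniqueness of Bernstein coefficients (`BernUnique.lean`) identifies them profile by profile:

  **`fullCount_pendant_dict`**: `A(k′, 1) = A(k′, 0) + 2 C(k′)`, `A(k′, 2) = 2 C(k′) + A(k′, 3)`,
  `C(k′) = cntPosB k′ − cntNegB k′` (the tensor-Bernstein coefficient of `β₁` on `K₅`),

the typed Theorem 13 (M2-34's dictionary `S₁ − S₀ = 2Π_τ β₁(τ)` in the tree).  Hence
**`typedPM_K5pendant`**: for every typed edge set `F ∋ 10`, pinning `z` and type map `τ` with values in `{1, 2}`,
`typedCount F z (τ[10 := 0]) K3 ≤ typedCount F z (τ[10 := 1]) K3` — the instance of night-3's typed (PM)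
(`TypedPendantA3.PM`, the hypothesis `hPM` of `typedCount_pendant_a3_of_PM`) on every pendant instance over
a five-vertex base, with the other three bases `S₀ ≤ S₁ ≤ …` relations `typedCount_pendant_a3_quadratic`'s.
-/

namespace Summit.Ventures.PercRepro2

open CovForm Hub

namespace K5

namespace Pendant

section Typed

variable {R : Type*} [Field R] [LinearOrder R] [IsStrictOrderedRing R]

/-- The full-profile typed counts of `K3` on the pendant instance. -/
noncomputable def A (k : Fin 11 → Fin 4) : R := PMTyped.fullCount (K3 ends6 0 1 2 5 4) k

/-- The tensor-Bernstein coefficient of `β₁` on `K₅` (the kernel certificate's signed count). -/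
noncomputable def C (k' : Fin 10 → Fin 4) : R := ((PM.cntPosB k' : ℕ) : R) - ((PM.cntNegB k' : ℕ) : R)

/-- `C ≥ 0` (the kernel certificates `certL`, `certH`, `certA`). -/
lemma C_nonneg (k' : Fin 10 → Fin 4) : 0 ≤ (C k' : R) := by
  unfold C; rw [sub_nonneg]; exact_mod_cast PM.cntNegB_le_cntPosB k'

omit [LinearOrder R] [IsStrictOrderedRing R] in
/-- The Bernstein basis on `Fin 11` splits off the pendant edge. -/
lemma bern_snoc (p : Fin 11 → R) (k' : Fin 10 → Fin 4) (j : Fin 4) :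
    bern p (Fin.snoc (α := fun _ => Fin 4) k' j) =
      bern (p ∘ Fin.castSucc) k' *
        (p (Fin.last 10) ^ (j : ℕ) * (1 - p (Fin.last 10)) ^ (3 - (j : ℕ))) := by
  unfold bern
  rw [Fin.prod_univ_castSucc]
  simp only [Fin.snoc_castSucc, Fin.snoc_last, Function.comp_apply]

omit [LinearOrder R] [IsStrictOrderedRing R] in
/-- Sums over the profiles on `Fin 11` split off the pendant edge. -/
lemma sum_snoc (g : (Fin 11 → Fin 4) → R) :
    ∑ k, g k = ∑ k' : Fin 10 → Fin 4, ∑ j : Fin 4, g (Fin.snoc (α := fun _ => Fin 4) k' j) := by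
  rw [← (Fin.snocEquiv fun _ => Fin 4).sum_comp, Fintype.sum_prod_type, Finset.sum_comm]
  rfl

omit [Field R] [LinearOrder R] [IsStrictOrderedRing R] in
/-- Pinning the pendant edge does not change the `K₅` weights. -/
lemma update_comp_castSucc {α : Type*} (p : Fin 11 → α) (c : α) :
    (Function.update p (Fin.last 10) c) ∘ Fin.castSucc = p ∘ Fin.castSucc := by
  funext e
  simp only [Function.comp_apply]
  exact Function.update_of_ne (Fin.castSucc_ne_last e) c p

/-- **`Gc` on the pendant instance as a Bernstein form**, the pendant edge split off. -/
theorem Gc_eq_bern6 (p : Fin 11 → R) :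
    Gc p ends6 0 1 2 5 4 =
      ∑ k' : Fin 10 → Fin 4, ∑ j : Fin 4, bern (p ∘ Fin.castSucc) k' *
        (p (Fin.last 10) ^ (j : ℕ) * (1 - p (Fin.last 10)) ^ (3 - (j : ℕ))) *
          A (Fin.snoc (α := fun _ => Fin 4) k' j) := by
  rw [hcov_cubic p ends6 0 1 2 5 4 (fun _ => 0), PMTyped.triSum_empty_eq_bern, sum_snoc]
  simp only [bern_snoc, A]

/-- `Gc` with the pendant edge pinned closed. -/
theorem Gc_zero_eq_bern (p : Fin 11 → R) :
    Gc (Function.update p (Fin.last 10) 0) ends6 0 1 2 5 4 =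
      ∑ k' : Fin 10 → Fin 4, bern (p ∘ Fin.castSucc) k' * A (Fin.snoc (α := fun _ => Fin 4) k' 0) := by
  rw [Gc_eq_bern6, update_comp_castSucc]
  refine Finset.sum_congr rfl fun k' _ => ?_
  simp [Fin.sum_univ_four]

/-- `Gc` with the pendant edge pinned open. -/
theorem Gc_one_eq_bern (p : Fin 11 → R) :
    Gc (Function.update p (Fin.last 10) 1) ends6 0 1 2 5 4 =
      ∑ k' : Fin 10 → Fin 4, bern (p ∘ Fin.castSucc) k' * A (Fin.snoc (α := fun _ => Fin 4) k' 3) := by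
  rw [Gc_eq_bern6, update_comp_castSucc]
  refine Finset.sum_congr rfl fun k' _ => ?_
  simp [Fin.sum_univ_four]

omit [LinearOrder R] [IsStrictOrderedRing R] in
/-- **The transfer of `β₁`**: with the pendant edge pinned closed, `β₁` on `ends6` is `β₁` on `ends5`. -/
theorem beta1_transfer (p : Fin 11 → R) :
    prob (Function.update p (Fin.last 10) 0) (connEvent ends6 1 2)ᶜ *
          (prob (Function.update p (Fin.last 10) 0) (connEvent ends6 1 2)ᶜ * prob (Function.update p (Fin.last 10) 0) (connEvent ends6 1 4 ∩ connEvent ends6 2 3 ∩ (connEvent ends6 1 0 ∪ connEvent ends6 2 0) ∩ (connEvent ends6 1 2)ᶜ) -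
            prob (Function.update p (Fin.last 10) 0) (connEvent ends6 1 4 ∩ (connEvent ends6 1 2)ᶜ) * prob (Function.update p (Fin.last 10) 0) (connEvent ends6 2 3 ∩ (connEvent ends6 1 0 ∪ connEvent ends6 2 0) ∩ (connEvent ends6 1 2)ᶜ)) -
        prob (Function.update p (Fin.last 10) 0) ((connEvent ends6 1 0 ∪ connEvent ends6 2 0) ∩ (connEvent ends6 1 2)ᶜ) *
          (prob (Function.update p (Fin.last 10) 0) (connEvent ends6 1 2)ᶜ * prob (Function.update p (Fin.last 10) 0) (connEvent ends6 1 4 ∩ connEvent ends6 2 3 ∩ (connEvent ends6 1 2)ᶜ) -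
            prob (Function.update p (Fin.last 10) 0) (connEvent ends6 1 4 ∩ (connEvent ends6 1 2)ᶜ) * prob (Function.update p (Fin.last 10) 0) (connEvent ends6 2 3 ∩ (connEvent ends6 1 2)ᶜ)) -
        prob (Function.update p (Fin.last 10) 0) (connEvent ends6 1 2)ᶜ *
          (prob (Function.update p (Fin.last 10) 0) (connEvent ends6 1 2)ᶜ * prob (Function.update p (Fin.last 10) 0) (connEvent ends6 1 4 ∩ connEvent ends6 2 0 ∩ (connEvent ends6 1 2)ᶜ) -
            prob (Function.update p (Fin.last 10) 0) (connEvent ends6 1 4 ∩ (connEvent ends6 1 2)ᶜ) * prob (Function.update p (Fin.last 10) 0) (connEvent ends6 2 0 ∩ (connEvent ends6 1 2)ᶜ)) +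
        prob (Function.update p (Fin.last 10) 0) (connEvent ends6 1 2)ᶜ *
          (prob (Function.update p (Fin.last 10) 0) (connEvent ends6 1 2)ᶜ * prob (Function.update p (Fin.last 10) 0) (connEvent ends6 2 4 ∩ connEvent ends6 1 3 ∩ (connEvent ends6 1 0 ∪ connEvent ends6 2 0) ∩ (connEvent ends6 1 2)ᶜ) -
            prob (Function.update p (Fin.last 10) 0) (connEvent ends6 2 4 ∩ (connEvent ends6 1 2)ᶜ) * prob (Function.update p (Fin.last 10) 0) (connEvent ends6 1 3 ∩ (connEvent ends6 1 0 ∪ connEvent ends6 2 0) ∩ (connEvent ends6 1 2)ᶜ)) -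
        prob (Function.update p (Fin.last 10) 0) ((connEvent ends6 1 0 ∪ connEvent ends6 2 0) ∩ (connEvent ends6 1 2)ᶜ) *
          (prob (Function.update p (Fin.last 10) 0) (connEvent ends6 1 2)ᶜ * prob (Function.update p (Fin.last 10) 0) (connEvent ends6 2 4 ∩ connEvent ends6 1 3 ∩ (connEvent ends6 1 2)ᶜ) -
            prob (Function.update p (Fin.last 10) 0) (connEvent ends6 2 4 ∩ (connEvent ends6 1 2)ᶜ) * prob (Function.update p (Fin.last 10) 0) (connEvent ends6 1 3 ∩ (connEvent ends6 1 2)ᶜ)) -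
        prob (Function.update p (Fin.last 10) 0) (connEvent ends6 1 2)ᶜ *
          (prob (Function.update p (Fin.last 10) 0) (connEvent ends6 1 2)ᶜ * prob (Function.update p (Fin.last 10) 0) (connEvent ends6 2 4 ∩ connEvent ends6 1 0 ∩ (connEvent ends6 1 2)ᶜ) -
            prob (Function.update p (Fin.last 10) 0) (connEvent ends6 2 4 ∩ (connEvent ends6 1 2)ᶜ) * prob (Function.update p (Fin.last 10) 0) (connEvent ends6 1 0 ∩ (connEvent ends6 1 2)ᶜ)) +
        (prob (Function.update p (Fin.last 10) 0) ((connEvent ends6 1 3 ∪ connEvent ends6 2 3) ∩ (connEvent ends6 1 2)ᶜ) - prob (Function.update p (Fin.last 10) 0) (connEvent ends6 1 2)ᶜ) *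
          (prob (Function.update p (Fin.last 10) 0) (connEvent ends6 1 2)ᶜ * prob (Function.update p (Fin.last 10) 0) (connEvent ends6 1 4 ∩ connEvent ends6 2 0 ∩ (connEvent ends6 1 2)ᶜ) - prob (Function.update p (Fin.last 10) 0) (connEvent ends6 1 4 ∩ (connEvent ends6 1 2)ᶜ) * prob (Function.update p (Fin.last 10) 0) (connEvent ends6 2 0 ∩ (connEvent ends6 1 2)ᶜ) +
            prob (Function.update p (Fin.last 10) 0) (connEvent ends6 1 2)ᶜ * prob (Function.update p (Fin.last 10) 0) (connEvent ends6 2 4 ∩ connEvent ends6 1 0 ∩ (connEvent ends6 1 2)ᶜ) - prob (Function.update p (Fin.last 10) 0) (connEvent ends6 2 4 ∩ (connEvent ends6 1 2)ᶜ) * prob (Function.update p (Fin.last 10) 0) (connEvent ends6 1 0 ∩ (connEvent ends6 1 2)ᶜ)) =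
      prob ((Function.update p (Fin.last 10) 0) ∘ Fin.castSucc) (connEvent ends5 1 2)ᶜ *
          (prob ((Function.update p (Fin.last 10) 0) ∘ Fin.castSucc) (connEvent ends5 1 2)ᶜ * prob ((Function.update p (Fin.last 10) 0) ∘ Fin.castSucc) (connEvent ends5 1 4 ∩ connEvent ends5 2 3 ∩ (connEvent ends5 1 0 ∪ connEvent ends5 2 0) ∩ (connEvent ends5 1 2)ᶜ) -
            prob ((Function.update p (Fin.last 10) 0) ∘ Fin.castSucc) (connEvent ends5 1 4 ∩ (connEvent ends5 1 2)ᶜ) * prob ((Function.update p (Fin.last 10) 0) ∘ Fin.castSucc) (connEvent ends5 2 3 ∩ (connEvent ends5 1 0 ∪ connEvent ends5 2 0) ∩ (connEvent ends5 1 2)ᶜ)) -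
        prob ((Function.update p (Fin.last 10) 0) ∘ Fin.castSucc) ((connEvent ends5 1 0 ∪ connEvent ends5 2 0) ∩ (connEvent ends5 1 2)ᶜ) *
          (prob ((Function.update p (Fin.last 10) 0) ∘ Fin.castSucc) (connEvent ends5 1 2)ᶜ * prob ((Function.update p (Fin.last 10) 0) ∘ Fin.castSucc) (connEvent ends5 1 4 ∩ connEvent ends5 2 3 ∩ (connEvent ends5 1 2)ᶜ) -
            prob ((Function.update p (Fin.last 10) 0) ∘ Fin.castSucc) (connEvent ends5 1 4 ∩ (connEvent ends5 1 2)ᶜ) * prob ((Function.update p (Fin.last 10) 0) ∘ Fin.castSucc) (connEvent ends5 2 3 ∩ (connEvent ends5 1 2)ᶜ)) -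
        prob ((Function.update p (Fin.last 10) 0) ∘ Fin.castSucc) (connEvent ends5 1 2)ᶜ *
          (prob ((Function.update p (Fin.last 10) 0) ∘ Fin.castSucc) (connEvent ends5 1 2)ᶜ * prob ((Function.update p (Fin.last 10) 0) ∘ Fin.castSucc) (connEvent ends5 1 4 ∩ connEvent ends5 2 0 ∩ (connEvent ends5 1 2)ᶜ) -
            prob ((Function.update p (Fin.last 10) 0) ∘ Fin.castSucc) (connEvent ends5 1 4 ∩ (connEvent ends5 1 2)ᶜ) * prob ((Function.update p (Fin.last 10) 0) ∘ Fin.castSucc) (connEvent ends5 2 0 ∩ (connEvent ends5 1 2)ᶜ)) +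
        prob ((Function.update p (Fin.last 10) 0) ∘ Fin.castSucc) (connEvent ends5 1 2)ᶜ *
          (prob ((Function.update p (Fin.last 10) 0) ∘ Fin.castSucc) (connEvent ends5 1 2)ᶜ * prob ((Function.update p (Fin.last 10) 0) ∘ Fin.castSucc) (connEvent ends5 2 4 ∩ connEvent ends5 1 3 ∩ (connEvent ends5 1 0 ∪ connEvent ends5 2 0) ∩ (connEvent ends5 1 2)ᶜ) -
            prob ((Function.update p (Fin.last 10) 0) ∘ Fin.castSucc) (connEvent ends5 2 4 ∩ (connEvent ends5 1 2)ᶜ) * prob ((Function.update p (Fin.last 10) 0) ∘ Fin.castSucc) (connEvent ends5 1 3 ∩ (connEvent ends5 1 0 ∪ connEvent ends5 2 0) ∩ (connEvent ends5 1 2)ᶜ)) -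
        prob ((Function.update p (Fin.last 10) 0) ∘ Fin.castSucc) ((connEvent ends5 1 0 ∪ connEvent ends5 2 0) ∩ (connEvent ends5 1 2)ᶜ) *
          (prob ((Function.update p (Fin.last 10) 0) ∘ Fin.castSucc) (connEvent ends5 1 2)ᶜ * prob ((Function.update p (Fin.last 10) 0) ∘ Fin.castSucc) (connEvent ends5 2 4 ∩ connEvent ends5 1 3 ∩ (connEvent ends5 1 2)ᶜ) -
            prob ((Function.update p (Fin.last 10) 0) ∘ Fin.castSucc) (connEvent ends5 2 4 ∩ (connEvent ends5 1 2)ᶜ) * prob ((Function.update p (Fin.last 10) 0) ∘ Fin.castSucc) (connEvent ends5 1 3 ∩ (connEvent ends5 1 2)ᶜ)) -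
        prob ((Function.update p (Fin.last 10) 0) ∘ Fin.castSucc) (connEvent ends5 1 2)ᶜ *
          (prob ((Function.update p (Fin.last 10) 0) ∘ Fin.castSucc) (connEvent ends5 1 2)ᶜ * prob ((Function.update p (Fin.last 10) 0) ∘ Fin.castSucc) (connEvent ends5 2 4 ∩ connEvent ends5 1 0 ∩ (connEvent ends5 1 2)ᶜ) -
            prob ((Function.update p (Fin.last 10) 0) ∘ Fin.castSucc) (connEvent ends5 2 4 ∩ (connEvent ends5 1 2)ᶜ) * prob ((Function.update p (Fin.last 10) 0) ∘ Fin.castSucc) (connEvent ends5 1 0 ∩ (connEvent ends5 1 2)ᶜ)) +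
        (prob ((Function.update p (Fin.last 10) 0) ∘ Fin.castSucc) ((connEvent ends5 1 3 ∪ connEvent ends5 2 3) ∩ (connEvent ends5 1 2)ᶜ) - prob ((Function.update p (Fin.last 10) 0) ∘ Fin.castSucc) (connEvent ends5 1 2)ᶜ) *
          (prob ((Function.update p (Fin.last 10) 0) ∘ Fin.castSucc) (connEvent ends5 1 2)ᶜ * prob ((Function.update p (Fin.last 10) 0) ∘ Fin.castSucc) (connEvent ends5 1 4 ∩ connEvent ends5 2 0 ∩ (connEvent ends5 1 2)ᶜ) - prob ((Function.update p (Fin.last 10) 0) ∘ Fin.castSucc) (connEvent ends5 1 4 ∩ (connEvent ends5 1 2)ᶜ) * prob ((Function.update p (Fin.last 10) 0) ∘ Fin.castSucc) (connEvent ends5 2 0 ∩ (connEvent ends5 1 2)ᶜ) +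
            prob ((Function.update p (Fin.last 10) 0) ∘ Fin.castSucc) (connEvent ends5 1 2)ᶜ * prob ((Function.update p (Fin.last 10) 0) ∘ Fin.castSucc) (connEvent ends5 2 4 ∩ connEvent ends5 1 0 ∩ (connEvent ends5 1 2)ᶜ) - prob ((Function.update p (Fin.last 10) 0) ∘ Fin.castSucc) (connEvent ends5 2 4 ∩ (connEvent ends5 1 2)ᶜ) * prob ((Function.update p (Fin.last 10) 0) ∘ Fin.castSucc) (connEvent ends5 1 0 ∩ (connEvent ends5 1 2)ᶜ)) := by
  simp only [c12, c14, c23, c10, c20, c24, c13, ← Set.preimage_inter, ← Set.preimage_union,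
    ← Set.preimage_compl, prob_res]

/-- **`2β₁′` with the pendant edge pinned closed, in the Bernstein basis of the `K₅` edges**: the
coefficients are `2 C(k′)`, the kernel certificate's signed counts. -/
theorem twoBeta1_zero_eq_bern (p : Fin 11 → R) :
    PMPendant.twoBeta1 (Function.update p (Fin.last 10) 0) ends6 0 1 2 5 3 4 =
      ∑ k' : Fin 10 → Fin 4, bern (p ∘ Fin.castSucc) k' * (2 * C k') := by
  rw [PMPendant.twoBeta1_eq (ends := ends6) (a₃ := 5) (u := 3) (f := Fin.last 10)
    (by rw [ends6_last, Sym2.eq_swap]) leaf_five (by decide) p 0 1 2 4 (by decide) (by decide),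
    beta1_transfer, PM.beta1_eq_bern, update_comp_castSucc, Finset.mul_sum]
  refine Finset.sum_congr rfl fun k' _ => ?_
  unfold C
  ring

/-- The right-hand side's coefficients: the four pendant types read off the dictionary. -/
noncomputable def B (k : Fin 11 → Fin 4) : R :=
  if k (Fin.last 10) = 0 then A (Fin.snoc (α := fun _ => Fin 4) (Fin.init k) 0)
  else if k (Fin.last 10) = 1 then A (Fin.snoc (α := fun _ => Fin 4) (Fin.init k) 0) + 2 * C (Fin.init k)
  else if k (Fin.last 10) = 2 then 2 * C (Fin.init k) + A (Fin.snoc (α := fun _ => Fin 4) (Fin.init k) 3)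
  else A (Fin.snoc (α := fun _ => Fin 4) (Fin.init k) 3)

omit [LinearOrder R] [IsStrictOrderedRing R] in
/-- `B` on a `snoc`. -/
lemma B_snoc (k' : Fin 10 → Fin 4) (j : Fin 4) :
    (B (Fin.snoc (α := fun _ => Fin 4) k' j) : R) =
      if j = 0 then (A (Fin.snoc (α := fun _ => Fin 4) k' 0) : R)
      else if j = 1 then A (Fin.snoc (α := fun _ => Fin 4) k' 0) + 2 * C k'
      else if j = 2 then 2 * C k' + A (Fin.snoc (α := fun _ => Fin 4) k' 3)
      else A (Fin.snoc (α := fun _ => Fin 4) k' 3) := by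
  unfold B
  simp only [Fin.snoc_last, Fin.init_snoc]

/-- `Gc` on the pendant instance as a full Bernstein form with coefficients `A`. -/
theorem Gc_eq_bern_full6 (p : Fin 11 → R) : Gc p ends6 0 1 2 5 4 = ∑ k, bern p k * A k := by
  rw [hcov_cubic p ends6 0 1 2 5 4 (fun _ => 0), PMTyped.triSum_empty_eq_bern]
  rfl

/-- **The two Bernstein expansions of `Gc` agree as functions of `p`.** -/
theorem bern_identity (p : Fin 11 → R) : ∑ k, bern p k * A k = ∑ k, bern p k * B k := by
  rw [← Gc_eq_bern_full6, PMPendant.Gc_pendant_quadratic (ends := ends6) (a₃ := 5) (u := 3)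
    (f := Fin.last 10) (by rw [ends6_last, Sym2.eq_swap]) leaf_five (by decide) p 0 1 2 4 (by decide)
    (by decide) (by decide) (by decide), Gc_zero_eq_bern, twoBeta1_zero_eq_bern, Gc_one_eq_bern,
    sum_snoc (fun k => bern p k * B k)]
  simp only [bern_snoc, B_snoc, Finset.mul_sum, Fin.sum_univ_four]
  rw [← Finset.sum_add_distrib, ← Finset.sum_add_distrib]
  refine Finset.sum_congr rfl fun k' _ => ?_
  simp only [Fin.isValue, Fin.val_zero, Fin.val_one, Fin.val_two, show ((3 : Fin 4) : ℕ) = 3 from rfl,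
    Fin.reduceEq, if_true, if_false]
  ring

/-- **THE TYPED DICTIONARY (Theorem 13 per profile)**: `A = B` — in particular
`A(k′, 1) = A(k′, 0) + 2 C(k′)` and `A(k′, 2) = 2 C(k′) + A(k′, 3)`. -/
theorem fullCount_pendant_dict : (A : (Fin 11 → Fin 4) → R) = B :=
  bern_coeff_unique fun i => bern_identity (fun e => (grid (i e) : R))

/-- **The typed (PM) on every pendant profile**: `A(k′, 0) ≤ A(k′, 1)`. -/
theorem typedPM_fullCount (k' : Fin 10 → Fin 4) :
    A (Fin.snoc (α := fun _ => Fin 4) k' 0) ≤ (A (Fin.snoc (α := fun _ => Fin 4) k' 1) : R) := by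
  have h := congrFun (fullCount_pendant_dict (R := R)) (Fin.snoc (α := fun _ => Fin 4) k' 1)
  rw [B_snoc] at h
  simp only [show ((1 : Fin 4) = 0) = False from by decide, if_false, if_true] at h
  rw [h]
  linarith [C_nonneg (R := R) k']


/-- The full profile of a pinned typed count with the pendant edge re-typed: the `K₅` part does not see the
pendant type. -/
lemma fullProfile_init (F : Finset (Fin 11)) (z : Config (Fin 11)) (τ : Fin 11 → ℕ) (j : ℕ)
    (h : ∀ e ∈ F, Function.update τ (Fin.last 10) j e ≤ 3) (h' : ∀ e ∈ F, τ e ≤ 3) (e : Fin 10) :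
    PMTyped.fullProfile F z (Function.update τ (Fin.last 10) j) h (Fin.castSucc e) =
      PMTyped.fullProfile F z τ h' (Fin.castSucc e) := by
  unfold PMTyped.fullProfile
  by_cases he : Fin.castSucc e ∈ F
  · rw [dif_pos he, dif_pos he]
    exact Fin.ext (Function.update_of_ne (Fin.castSucc_ne_last e) j τ)
  · rw [dif_neg he, dif_neg he]

/-- The full profile of a pinned typed count at the pendant edge (typed, re-typed to `j ≤ 3`). -/
lemma fullProfile_last (F : Finset (Fin 11)) (z : Config (Fin 11)) (τ : Fin 11 → ℕ) (j : ℕ)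
    (hF : Fin.last 10 ∈ F) (h : ∀ e ∈ F, Function.update τ (Fin.last 10) j e ≤ 3) :
    ((PMTyped.fullProfile F z (Function.update τ (Fin.last 10) j) h (Fin.last 10) : Fin 4) : ℕ) = j := by
  unfold PMTyped.fullProfile
  rw [dif_pos hF]
  simp

/-- **THE TYPED (PM) ON EVERY `K₅ + PENDANT a₃` INSTANCE** — for every typed edge set `F` containing the pendant
edge `10`, every pinning `z` and every type map `τ` with values in `{1, 2}` on `F`:
`typedCount F z (τ[10 := 0]) K3 ≤ typedCount F z (τ[10 := 1]) K3` (the instance of `TypedPendantA3.PM`, the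
hypothesis `hPM` of `typedCount_pendant_a3_of_PM`, on `ends6` with the marks `(o, a₁, a₂, a₃, b) = (0, 1, 2, 5, 4)`,
the leaf `a₃ = 5` at `u = 3`). -/
theorem typedPM_K5pendant (F : Finset (Fin 11)) (z : Config (Fin 11)) (τ : Fin 11 → ℕ)
    (hF : Fin.last 10 ∈ F) (hτ : ∀ e ∈ F, τ e = 1 ∨ τ e = 2) :
    typedCount F z (Function.update τ (Fin.last 10) 0)
        (K3 ends6 0 1 2 5 4 : Config (Fin 11) → Config (Fin 11) → Config (Fin 11) → R) ≤
      typedCount F z (Function.update τ (Fin.last 10) 1) (K3 ends6 0 1 2 5 4) := by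
  have h' : ∀ e ∈ F, τ e ≤ 3 := fun e he => by rcases hτ e he with h | h <;> omega
  have h0 : ∀ e ∈ F, Function.update τ (Fin.last 10) 0 e ≤ 3 := fun e he => by
    by_cases hef : e = Fin.last 10
    · subst hef; simp
    · rw [Function.update_of_ne hef]; exact h' e he
  have h1 : ∀ e ∈ F, Function.update τ (Fin.last 10) 1 e ≤ 3 := fun e he => by
    by_cases hef : e = Fin.last 10
    · subst hef; simp
    · rw [Function.update_of_ne hef]; exact h' e he
  rw [PMTyped.typedCount_eq_fullCount F z _ h0, PMTyped.typedCount_eq_fullCount F z _ h1]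
  set k' : Fin 10 → Fin 4 := fun e => PMTyped.fullProfile F z τ h' (Fin.castSucc e) with hk'
  have e0 : PMTyped.fullProfile F z (Function.update τ (Fin.last 10) 0) h0 =
      Fin.snoc (α := fun _ => Fin 4) k' 0 := by
    rw [← Fin.snoc_init_self (PMTyped.fullProfile F z (Function.update τ (Fin.last 10) 0) h0)]
    congr 1
    · funext e; simp only [Fin.init, hk']; exact fullProfile_init F z τ 0 h0 h' e
    · exact Fin.ext (fullProfile_last F z τ 0 hF h0)
  have e1 : PMTyped.fullProfile F z (Function.update τ (Fin.last 10) 1) h1 =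
      Fin.snoc (α := fun _ => Fin 4) k' 1 := by
    rw [← Fin.snoc_init_self (PMTyped.fullProfile F z (Function.update τ (Fin.last 10) 1) h1)]
    congr 1
    · funext e; simp only [Fin.init, hk']; exact fullProfile_init F z τ 1 h1 h' e
    · exact Fin.ext (fullProfile_last F z τ 1 hF h1)
  rw [e0, e1]
  exact typedPM_fullCount k'


end Typed

end Pendant

end K5

end Summit.Ventures.PercRepro2
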